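import Mathlib
import HarnessLib

/-!
# Route `BECHardSphereReduction`, crux `HardSphereBEC` (stmt-AtomisticToContinuum-11885),
# line `registered` (`Lines/birth.lean`): the registered stub `stub_oneSidedBaire`

Supports (does not close) stmt-AtomisticToContinuum-11885; stub `stub_oneSidedBaire` (S5) of the
birth line, the abstract ONE-SIDED BAIRE LEMMA used by the Baire uniformisation of the dilation
ratio (`stub_smallRatio_of`).

**Statement.** Let `A : ℕ → Set ℝ` and `lo < hi`.  Assume the sets `A n` cover the open interval
`(lo, hi)` and each `A n` is closed, inside `(lo, hi)`, under limits of its own points from the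
LEFT: if every interval `(a - ε, a)` (`ε > 0`) meets `A n`, then `a ∈ A n`.  Then some `A n`
contains a nondegenerate closed interval `[a₁, a₂] ⊆ [lo, hi]`.

**Proof.** Fix `lo < lo' < hi' < hi`.  The closed sets `(lo', hi')ᶜ` and
`closure (A n ∩ [lo', hi'])` (`n : ℕ`) cover `ℝ`, so by the Baire category theorem in the complete
metric space `ℝ` (`dense_iUnion_interior_of_closed`) the union of their interiors is dense, hence
meets the nonempty open interval `(lo', hi')` in a point `y`.  The point `y` is not interior to
`(lo', hi')ᶜ`, so some open interval `J = (y - δ, y + δ)` lies in `closure (A n ∩ [lo', hi'])`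
(in particular `J ⊆ [lo', hi'] ⊆ (lo, hi)`).  Every `a ∈ J` is then a left limit of points of
`A n` (each `(a - ε, a) ∩ J` is a nonempty open subset of the closure, so it meets `A n`), whence
`a ∈ A n` by the one-sided closedness; thus `[y, y + δ/2] ⊆ J ⊆ A n`.

Pure topology of `ℝ`; Mathlib only.  [folklore]
-/

namespace Summit.AtomisticToContinuum.BoseEinsteinCondensation.Cruxes.HardSphereBEC.Birth

/-- **S5 — ONE-SIDED BAIRE ON AN INTERVAL.**  If countably many sets `A n` cover the open interval
`(lo, hi)` (`lo < hi`) and each `A n` is closed, inside `(lo, hi)`, under limits of its points from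
the left (whenever every `(a - ε, a)`, `ε > 0`, meets `A n`, the point `a` lies in `A n`), then some
`A n` contains a nondegenerate closed interval `[a₁, a₂]` with `lo ≤ a₁ < a₂ ≤ hi`.
(Baire category in `ℝ` applied to the closed cover by `(lo', hi')ᶜ` and the closures of
`A n ∩ [lo', hi']` for a compact sub-interval `[lo', hi'] ⊆ (lo, hi)`; a left-closed set that is
dense in an open sub-interval of `(lo, hi)` contains it.) [folklore] -/
theorem stub_oneSidedBaire :
    ∀ (A : ℕ → Set ℝ) (lo hi : ℝ), lo < hi → (∀ a : ℝ, lo < a → a < hi → ∃ n : ℕ, a ∈ A n) → (∀ (n : ℕ) (a : ℝ), lo < a → a < hi → (∀ ε : ℝ, 0 < ε → ∃ b : ℝ, a - ε < b ∧ b < a ∧ b ∈ A n) → a ∈ A n) → ∃ (n : ℕ) (a₁ a₂ : ℝ), lo ≤ a₁ ∧ a₁ < a₂ ∧ a₂ ≤ hi ∧ ∀ a : ℝ, a₁ ≤ a → a ≤ a₂ → a ∈ A n := by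
  intro A lo hi hlt hcover hleft
  -- a compact sub-interval `[lo', hi']` of `(lo, hi)`
  obtain ⟨lo', hlo', hlo'hi⟩ := exists_between hlt
  obtain ⟨hi', hlohi', hhi'⟩ := exists_between hlo'hi
  -- the countable closed cover of `ℝ` by `(lo', hi')ᶜ` and the closures of `A n ∩ [lo', hi']`
  have hclosed : ∀ i : Option ℕ,
      IsClosed (i.elim (Set.Ioo lo' hi')ᶜ fun n => closure (A n ∩ Set.Icc lo' hi')) := by
    rintro (_ | n)
    · exact isOpen_Ioo.isClosed_compl
    · exact isClosed_closure
  have hcov : (⋃ i : Option ℕ,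
      i.elim (Set.Ioo lo' hi')ᶜ fun n => closure (A n ∩ Set.Icc lo' hi')) = Set.univ := by
    refine Set.eq_univ_of_forall fun x => Set.mem_iUnion.2 ?_
    by_cases hx : x ∈ Set.Ioo lo' hi'
    · obtain ⟨n, hn⟩ := hcover x (hlo'.trans hx.1) (hx.2.trans hhi')
      exact ⟨some n, subset_closure ⟨hn, Set.Ioo_subset_Icc_self hx⟩⟩
    · exact ⟨none, hx⟩
  -- Baire: the interiors of the cover have dense union, which meets `(lo', hi')` in some `y`
  have hdense := dense_iUnion_interior_of_closed hclosed hcov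
  obtain ⟨y, hyU, hyI⟩ := hdense.exists_mem_open isOpen_Ioo (Set.nonempty_Ioo.2 hlohi')
  obtain ⟨_ | n, hyn⟩ := Set.mem_iUnion.1 hyU
  · -- `y ∈ (lo', hi')` is not interior to `(lo', hi')ᶜ`
    exact absurd hyI (interior_subset hyn)
  · -- `y` is interior to `closure (A n ∩ [lo', hi'])`: a whole interval `J` lies in it
    obtain ⟨δ, hδ, hball⟩ := Metric.isOpen_iff.1 isOpen_interior y hyn
    have hJcl : Set.Ioo (y - δ) (y + δ) ⊆ closure (A n ∩ Set.Icc lo' hi') := by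
      rw [← Real.ball_eq_Ioo]
      exact hball.trans interior_subset
    have hJIcc : Set.Ioo (y - δ) (y + δ) ⊆ Set.Icc lo' hi' :=
      hJcl.trans (closure_minimal Set.inter_subset_right isClosed_Icc)
    -- every point of `J` is a left limit of points of `A n`, hence lies in `A n`
    have hJA : ∀ a ∈ Set.Ioo (y - δ) (y + δ), a ∈ A n := by
      intro a ha
      have haI := hJIcc ha
      refine hleft n a (hlo'.trans_le haI.1) (haI.2.trans_lt hhi') fun ε hε => ?_
      obtain ⟨m, hm₁, hm₂, hma⟩ : ∃ m : ℝ, a - ε ≤ m ∧ y - δ ≤ m ∧ m < a :=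
        ⟨max (a - ε) (y - δ), le_max_left _ _, le_max_right _ _, max_lt (by linarith) ha.1⟩
      have hmid : (m + a) / 2 ∈ closure (A n ∩ Set.Icc lo' hi') :=
        hJcl ⟨by linarith, by linarith [ha.2]⟩
      rw [mem_closure_iff] at hmid
      obtain ⟨b, ⟨hb₁, hb₂⟩, hbA, -⟩ :=
        hmid (Set.Ioo m a) isOpen_Ioo ⟨by linarith, by linarith⟩
      exact ⟨b, by linarith, hb₂, hbA⟩
    refine ⟨n, y, y + δ / 2, (hlo'.trans hyI.1).le, by linarith, ?_, fun a ha₁ ha₂ => ?_⟩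
    · exact ((hJIcc ⟨by linarith, by linarith⟩).2.trans hhi'.le)
    · exact hJA a ⟨by linarith, by linarith⟩

end Summit.AtomisticToContinuum.BoseEinsteinCondensation.Cruxes.HardSphereBEC.Birth
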